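import Mathlib
import HarnessLib
import Summits.HubbardSuperconductivity.HubbardSuperconductivity.Theorems.KLProgrammeKLRegimeEnginePairTransferOutClassUnsmear
import Summits.HubbardSuperconductivity.HubbardSuperconductivity.Theorems.KLProgrammeKLRegimeEngineV8DefsG11Hosting

/-!
# Route `KLProgramme` — ENGINE item stmt-HubbardSuperconductivity-20437 `KLRegimeEngineV17F2`, stub (c) value lane: REGIME ONE-LINERS for the binders of
# `outClass_hout_klEngGeo13(_alpha)` that are not owner rows (cell gate-hubbard-kl, seat hubbard-kl-k3c2-p2 g19; memo OUT-OF-CLASS-E2.md §10)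

Three binders of the literal `hout` theorem (…OutClassHoutG13 / …OutClassHoutAlpha) are regime facts, discharged here once:
* `softSymbolCompl_succ_soft` — `hsoft`: the slice symbol `s^{Kₙ}_{n,n+1}` is a soft fraction `0 ≤ s ≤ 1 − w^{Kₙ}_{Λₙ}` (`isSoftSymbol_compl`);
* `klScale_le_klTorusNorm_of_not_isPairClassAt_succ` — `Λₙ ≤ |p_Qm|_𝕋` for `Qm` out of class at `n+1` (`Λₙ = ⅛·4^{−(n+1)}`);
* `relBarE2_le_share_eremBar` (g19 append) — `hE`: the class-#5 bar's non-gain residue `E₂` sits in `a·eremBar` under `2·klCT7·15367 ≤ a·Q.CR`,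
  `2·klCT7·15367·(Klam U)² ≤ a·Q.CL β n`; `relBar_klCT7_shares_half` discharges both at `a = ½` for every `Q` above `klEngQ5`'s floor (`Q.CR, Q.CL ≥ 2⁶⁰Psq²Rsq²…`);
* `le_sixteen_mul_of_sq_le` + **`unsmear_smallness_of_le`** — `hsm`: the Neumann smallness `m′·Σ_p|tₙ[φ](Qm,p)| ≤ 1/3` from the a priori `m′² ≤ 2⁸(Klam U)²`, the flat
  all-`Qm` mass line `Σ|t| ≤ 2¹⁶` (`sum_abs_klTransferWeight_le_of_frameOK`, any frame with `FrameOK`, `klBetaMin ≤ β ≤ L`) and the threshold `Klam·U ≤ 1/(3·2²⁰)`.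
Arithmetic over landed lemmas; nothing about the model is asserted; nothing asserts (E2″-F), (c), K3 or superconductivity.  0 kit · 0 lit.
-/

noncomputable section

namespace Summit.HubbardSuperconductivity.HubbardSuperconductivity.Theorems.KLRegimeSplit

set_option linter.dupNamespace false -- summit = problem name (single-conjunct summit), D-0017

open Real Finset Literature.MathematicalPhysics.QuantumLattice Literature.Probability.LatticeModels
open Summit.HubbardSuperconductivity.HubbardSuperconductivity.Theorems.KLProgrammeLegKernels
open Summit.HubbardSuperconductivity.HubbardSuperconductivity.Theorems.TwoPointAssembly
open Summit.HubbardSuperconductivity.HubbardSuperconductivity.Theorems.DispersionFlow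
open Summit.HubbardSuperconductivity.HubbardSuperconductivity.Theorems.EngineV8

section Model

variable {L M : ℕ}

/-- **`hsoft`**: the slice symbol `s^{K}_{n,n+1}` is a soft fraction at scale `n`: `0 ≤ s ≤ 1 − w^{K}_{Λₙ}` (any frame `K`). -/
theorem softSymbolCompl_succ_soft (β μ : ℝ) (K : TrigPolyC4v) (n : ℕ) (k : FreqMomentum L M) :
    0 ≤ softSymbolCompl L M β μ K n (n + 1) k ∧ softSymbolCompl L M β μ K n (n + 1) k ≤ 1 - hubbardCutoffWeightCT L M β μ K (klScale klE0 n) k :=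
  (isSoftSymbol_compl (L := L) (M := M) β μ K (Nat.le_succ n)).1 k

/-- **`Λₙ ≤ |p_Qm|_𝕋` out of class at `n+1`** (`|p_Qm|_𝕋 > 4^{−(n+1)} = 8Λₙ`). -/
theorem klScale_le_klTorusNorm_of_not_isPairClassAt_succ {n : ℕ} {Qm : TorusSite 2 L} (hQ : ¬ IsPairClassAt L Qm (n + 1)) :
    klScale klE0 n ≤ klTorusNorm L Qm := by
  unfold IsPairClassAt at hQ
  push Not at hQ
  have e : klScale klE0 n = 8⁻¹ * ((4 : ℝ) ^ (n + 1))⁻¹ := by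
    show klE0 * ((4 : ℝ) ^ n)⁻¹ = 8⁻¹ * ((4 : ℝ) ^ (n + 1))⁻¹
    unfold klE0; rw [pow_succ, mul_inv]; ring
  have hle : ((4 : ℝ) ^ (n + 1))⁻¹ ≤ klTorusNorm L Qm := hQ.le
  have h0 : 0 ≤ ((4 : ℝ) ^ (n + 1))⁻¹ := by positivity
  rw [e]; linarith

end Model

/-- `m′² ≤ 2⁸·K²`, `0 ≤ K` ⇒ `m′ ≤ 16·K`. -/
theorem le_sixteen_mul_of_sq_le {m' K : ℝ} (hK : 0 ≤ K) (h : m' ^ 2 ≤ 2 ^ 8 * K ^ 2) : m' ≤ 16 * K := by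
  have h16 : 0 ≤ 16 * K := by positivity
  nlinarith [sq_nonneg (m' - 16 * K), sq_nonneg (m' + 16 * K)]

section Smallness

variable {L M : ℕ} [NeZero L] {R : RenConsts} {U : ℝ} {N : ℕ} {β μ : ℝ} {K : TrigPolyC4v}

/-- **`hsm` — THE NEUMANN SMALLNESS FROM THE FLAT MASS LINE**: on an admissible frame (`FrameOK R U N μ K`, `klBetaMin ≤ β ≤ L`), for a soft fraction
`0 ≤ φ ≤ 1 − w^K_{Λₙ}`, an a priori `m′² ≤ 2⁸(Klam U)²` with `0 ≤ Klam·U ≤ 1/(3·2²⁰)`: `m′·Σ_p|tₙ[φ](Qm,p)| ≤ 1/3` at EVERY `Qm`. -/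
theorem unsmear_smallness_of_le (hK : FrameOK R U N μ K) (hβ : klBetaMin ≤ β) (hβL : β ≤ L) (n : ℕ)
    {φ : FreqMomentum L M → ℝ} (hφ : ∀ k, 0 ≤ φ k ∧ φ k ≤ 1 - hubbardCutoffWeightCT L M β μ K (klScale klE0 n) k)
    {P : SplitConsts} {m' : ℝ} (hm'K : m' ^ 2 ≤ 2 ^ 8 * (P.Klam * U) ^ 2) (hKU0 : 0 ≤ P.Klam * U)
    (hKU : P.Klam * U ≤ 1 / (3 * 2 ^ 20)) (Qm : TorusSite 2 L) :
    m' * ∑ p, |klTransferWeight L M β μ K n φ Qm p| ≤ 1 / 3 := by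
  have hmass := sum_abs_klTransferWeight_le_of_frameOK (M := M) hK hβ hβL n hφ Qm
  have hm16 := le_sixteen_mul_of_sq_le hKU0 hm'K
  have hS0 : 0 ≤ ∑ p, |klTransferWeight L M β μ K n φ Qm p| := sum_nonneg fun p _ => abs_nonneg _
  calc m' * ∑ p, |klTransferWeight L M β μ K n φ Qm p| ≤ (16 * (P.Klam * U)) * 2 ^ 16 :=
        mul_le_mul hm16 hmass hS0 (by positivity)
    _ ≤ 1 / 3 := by nlinarith

end Smallness

/-! ## The relative bar's erem residue at a share -/

section EremShare

variable {L : ℕ}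

/-- **`hE` for the class-#5 bar of record**: its non-gain residue `E₂ = 2·klCT7·15367·(Klam U)²/L + 4·klCT7·15367·(Klam|U|)³·2⁻⁽ⁿ⁺¹⁾`
(`relBar_klCT7_le_bars_klEngGeo11`, …OutClassHoutAlpha) sits in `a·eremBar G P Q U β L n` as soon as `2·klCT7·15367 ≤ a·Q.CR` and
`2·klCT7·15367·(Klam U)² ≤ a·Q.CL β n` (`0 ≤ a`, `0 ≤ G.cloc`, `0 ≤ Klam`); with `a = ½` and step (i) at share `s = ¼` this is the `hE` binder of `outClass_hout_klEngGeo13_alpha`. -/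
theorem relBarE2_le_share_eremBar (G : GeoConsts) (hcloc : 0 ≤ G.cloc) {P : SplitConsts} (hKl : 0 ≤ P.Klam) (R : RenConsts) (Q₀ Q : EngConsts) (G' : GeoConsts) {U β a : ℝ}
    (ha : 0 ≤ a) (L n : ℕ) (hCR : 2 * klCT7 P R Q₀ G' klEngGeoTh * 15367 ≤ a * Q.CR)
    (hCL : 2 * klCT7 P R Q₀ G' klEngGeoTh * 15367 * (P.Klam * U) ^ 2 ≤ a * Q.CL β n) :
    2 * klCT7 P R Q₀ G' klEngGeoTh * 15367 * ((P.Klam * U) ^ 2 * ((L : ℝ))⁻¹) +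
        4 * klCT7 P R Q₀ G' klEngGeoTh * 15367 * ((P.Klam * |U|) ^ 3 * ((2 : ℝ) ^ (n + 1))⁻¹) ≤
      a * eremBar G P Q U β L n := by
  unfold eremBar
  have hc7 := klCT7_nonneg P R Q₀ G' klEngGeoTh
  have hL : (0 : ℝ) ≤ ((L : ℝ))⁻¹ := by positivity
  have h2 : 0 < ((2 : ℝ) ^ n)⁻¹ := by positivity
  have hsucc : ((2 : ℝ) ^ (n + 1))⁻¹ = 2⁻¹ * ((2 : ℝ) ^ n)⁻¹ := by rw [pow_succ, mul_inv, mul_comm]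
  have hU3 : 0 ≤ (P.Klam * |U|) ^ 3 := by positivity
  have h4 : 0 < (4 : ℝ) ^ (-(G.θ * n)) := Real.rpow_pos_of_pos (by norm_num) _
  have hα : 0 ≤ a * (G.cloc * (P.Klam * U) ^ 2 * (4 : ℝ) ^ (-(G.θ * n))) := by positivity
  -- the `1/L` part
  have hγ : 2 * klCT7 P R Q₀ G' klEngGeoTh * 15367 * ((P.Klam * U) ^ 2 * ((L : ℝ))⁻¹) ≤ a * (Q.CL β n / L) := by
    rw [div_eq_mul_inv, ← mul_assoc, ← mul_assoc]
    exact mul_le_mul_of_nonneg_right (by linarith) hL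
  -- the cubic part
  have hβ : 4 * klCT7 P R Q₀ G' klEngGeoTh * 15367 * ((P.Klam * |U|) ^ 3 * ((2 : ℝ) ^ (n + 1))⁻¹) ≤ a * (Q.CR * (P.Klam * |U|) ^ 3 * ((2 : ℝ) ^ n)⁻¹) := by
    rw [hsucc]
    have e : 4 * klCT7 P R Q₀ G' klEngGeoTh * 15367 * ((P.Klam * |U|) ^ 3 * (2⁻¹ * ((2 : ℝ) ^ n)⁻¹)) =
        (2 * klCT7 P R Q₀ G' klEngGeoTh * 15367) * ((P.Klam * |U|) ^ 3 * ((2 : ℝ) ^ n)⁻¹) := by ring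
    rw [e, show a * (Q.CR * (P.Klam * |U|) ^ 3 * ((2 : ℝ) ^ n)⁻¹) = (a * Q.CR) * ((P.Klam * |U|) ^ 3 * ((2 : ℝ) ^ n)⁻¹) by ring]
    exact mul_le_mul_of_nonneg_right hCR (mul_nonneg hU3 h2.le)
  nlinarith [hγ, hβ, hα]

/-- **The share facts for the class-#5 bar DISCHARGED at the engine's `Q`-floor**: for every `Q` with `2⁶⁰·Psq²·Rsq² ≤ Q.CR` and `2⁶⁰·Psq²·Rsq²·(β²+1)·4ⁿ ≤ Q.CL β n`
(`klEngQ5` and its raises) and `(Klam U)² ≤ 1`: `2·klCT7·15367 ≤ ½·Q.CR` and `2·klCT7·15367·(Klam U)² ≤ ½·Q.CL β n` (`klCT7 ≤ klCTcap7 = 2²⁰`, `Psq, Rsq ≥ 1`). -/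
theorem relBar_klCT7_shares_half (P : SplitConsts) (R : RenConsts) (Q₀ Q : EngConsts) (G' : GeoConsts) {U β : ℝ} (n : ℕ) (hKU : (P.Klam * U) ^ 2 ≤ 1)
    (hQCR : 2 ^ 60 * klEngPsq P ^ 2 * klEngRsq R ^ 2 ≤ Q.CR) (hQCL : 2 ^ 60 * klEngPsq P ^ 2 * klEngRsq R ^ 2 * (β ^ 2 + 1) * (4 : ℝ) ^ n ≤ Q.CL β n) :
    2 * klCT7 P R Q₀ G' klEngGeoTh * 15367 ≤ 2⁻¹ * Q.CR ∧ 2 * klCT7 P R Q₀ G' klEngGeoTh * 15367 * (P.Klam * U) ^ 2 ≤ 2⁻¹ * Q.CL β n := by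
  have hc7 := klCT7_nonneg P R Q₀ G' klEngGeoTh
  have hcap : klCT7 P R Q₀ G' klEngGeoTh ≤ 2 ^ 20 := (klCT7_le_klCTcap7 P R Q₀ G' klEngGeoTh).trans (le_of_eq klCTcap7_eq)
  have hP := one_le_klEngPsq P
  have hR := one_le_klEngRsq R
  have hPR : 1 ≤ klEngPsq P ^ 2 * klEngRsq R ^ 2 := by nlinarith [one_le_pow₀ (n := 2) hP, one_le_pow₀ (n := 2) hR]
  have h60 : (2 : ℝ) ^ 60 ≤ Q.CR := by nlinarith
  have hb : (1 : ℝ) ≤ (β ^ 2 + 1) * (4 : ℝ) ^ n := by nlinarith [sq_nonneg β, one_le_pow₀ (n := n) (by norm_num : (1 : ℝ) ≤ 4)]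
  have h60' : (2 : ℝ) ^ 60 ≤ Q.CL β n := by nlinarith
  have hK0 : 0 ≤ (P.Klam * U) ^ 2 := sq_nonneg _
  constructor
  · nlinarith
  · nlinarith [mul_le_mul hcap hKU hK0 (by norm_num)]

end EremShare

end Summit.HubbardSuperconductivity.HubbardSuperconductivity.Theorems.KLRegimeSplit

end
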